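import Summits.Ventures.HodgeRepro2.BridgePairwise

/-!
# A CM type is determined by its determinant character

Blind cell `pub-hodge-repro2`, seat p1 (Tier 4; Lean support for sub-claim B3, owner p2, v0.9 §B3(c),
and for B4's Remark after Prop. B4.3).

TIER4 v0.9 B3(c) [P]: «If Φ, Φ′ ⊂ Hom(M, ℂ) satisfy ∏_{θ ∈ Φ} θ(x) = ∏_{θ ∈ Φ′} θ(x) for all
x ∈ M^× then Φ = Φ′» — the statement that the first bullet of Liu's Def. 4.5(2) (the determinant of
`i_μ(x)` on `Lie_E(A_μ)`) pins down the CM type of `A_μ ⊗_{τ′} ℂ`.  The printed proof takes a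
primitive element `a₀`, evaluates at `x = a₀ + t`, `t ∈ ℤ`, and compares the polynomials
`∏_{θ∈Φ}(t + θ(a₀))`.  This file carries out exactly that proof on top of p4's kernel-checked
`BridgePairwise.monoPoly_injective` (distinct exponent vectors give distinct polynomials
`∏ (X + C r_i)^{m_i}` when the `r_i` are pairwise distinct):

* `exists_separating_element` — a number field has an element at which distinct complex embeddings
  take distinct values (a primitive element, `Field.exists_primitive_element`).
* `detChar Φ x := ∏_{θ ∈ Φ} θ x` and **`eq_of_forall_detChar_eq`**: `detChar Φ = detChar Φ′ ⇒ Φ = Φ′`.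
  (Only the values at `x = a₀ + t`, `t ∈ ℕ`, are used — infinitely many points determine the
  polynomial, `Polynomial.eq_of_infinite_eval_eq`.)
-/

namespace Summit.Ventures.HodgeRepro2

open scoped Classical BigOperators

variable {M : Type*} [Field M] [NumberField M]

/-- A primitive element of the number field `M` separates its complex embeddings. -/
theorem exists_separating_element : ∃ a : M, Function.Injective fun θ : M →+* ℂ => θ a := by
  obtain ⟨α, hα⟩ := Field.exists_primitive_element ℚ M
  refine ⟨α, fun θ θ' h => ?_⟩
  have hint : IsAlgebraic ℚ α := Algebra.IsAlgebraic.isAlgebraic α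
  have htop : Algebra.adjoin ℚ ({α} : Set M) = ⊤ := by
    rw [← IntermediateField.adjoin_simple_toSubalgebra_of_isAlgebraic hint, hα,
      IntermediateField.top_toSubalgebra]
  have hx : Set.EqOn (⇑θ.toRatAlgHom) (⇑θ'.toRatAlgHom) ({α} : Set M) := by
    intro x hx
    rw [Set.mem_singleton_iff] at hx
    subst hx
    exact h
  have := AlgHom.ext_of_adjoin_eq_top htop hx
  exact RingHom.equivRatAlgHom.injective (by simpa [RingHom.equivRatAlgHom_apply] using this)

/-- The determinant character of a finite set of embeddings, `x ↦ ∏_{θ ∈ Φ} θ x`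
(for a CM type `Φ` of `M` acting on `Lie(A)`, the determinant of the action of `x`). -/
def detChar (Φ : Finset (M →+* ℂ)) (x : M) : ℂ := ∏ θ ∈ Φ, θ x

omit [NumberField M] in
/-- Unfolding lemma for `detChar`. -/
theorem detChar_def (Φ : Finset (M →+* ℂ)) (x : M) : detChar Φ x = ∏ θ ∈ Φ, θ x := rfl

/-- The value of `detChar Φ` at `a + t` is the evaluation at `t` of p4's polynomial
`monoPoly (θ ↦ θ a) (1_Φ)`. -/
theorem eval_monoPoly_indicator (Φ : Finset (M →+* ℂ)) (a : M) (t : ℕ) :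
    Polynomial.eval (t : ℂ)
        (BridgePairwise.monoPoly (fun θ : M →+* ℂ => θ a) fun θ => if θ ∈ Φ then 1 else 0) =
      detChar Φ (a + t) := by
  rw [BridgePairwise.eval_monoPoly, detChar]
  have : ∀ θ : M →+* ℂ, ((t : ℂ) + θ a) ^ (if θ ∈ Φ then 1 else 0) =
      if θ ∈ Φ then θ (a + t) else 1 := by
    intro θ
    by_cases hθ : θ ∈ Φ
    · simp [hθ, add_comm]
    · simp [hθ]
  simp only [this]
  rw [Finset.prod_ite_mem, Finset.univ_inter]

/-- **A finite set of embeddings is determined by its determinant character** (TIER4 B3(c)):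
if `∏_{θ ∈ Φ} θ x = ∏_{θ ∈ Φ′} θ x` for every `x ∈ M`, then `Φ = Φ′`. -/
theorem eq_of_forall_detChar_eq (Φ Φ' : Finset (M →+* ℂ))
    (h : ∀ x, detChar Φ x = detChar Φ' x) : Φ = Φ' := by
  obtain ⟨a, ha⟩ := exists_separating_element (M := M)
  have key : BridgePairwise.monoPoly (fun θ : M →+* ℂ => θ a) (fun θ => if θ ∈ Φ then 1 else 0) =
      BridgePairwise.monoPoly (fun θ : M →+* ℂ => θ a) (fun θ => if θ ∈ Φ' then 1 else 0) := by
    apply Polynomial.eq_of_infinite_eval_eq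
    refine Set.Infinite.mono ?_ (Set.infinite_range_of_injective (Nat.cast_injective (R := ℂ)))
    rintro _ ⟨t, rfl⟩
    simp only [Set.mem_setOf_eq]
    rw [eval_monoPoly_indicator, eval_monoPoly_indicator, h]
  have hm := BridgePairwise.monoPoly_injective _ ha key
  ext θ
  have := congrFun hm θ
  by_cases h1 : θ ∈ Φ <;> by_cases h2 : θ ∈ Φ' <;> simp [h1, h2] at this ⊢

/-- The form used in B3(c): it suffices to compare the determinant characters on `M^×`
(the value at `0` is `0` for non-empty sets and `1` for the empty set, so the restriction to
`M ∖ {0}` still determines the set when both sets are non-empty). -/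
theorem eq_of_forall_ne_zero_detChar_eq (Φ Φ' : Finset (M →+* ℂ)) (hΦ : Φ.Nonempty)
    (hΦ' : Φ'.Nonempty) (h : ∀ x, x ≠ 0 → detChar Φ x = detChar Φ' x) : Φ = Φ' := by
  refine eq_of_forall_detChar_eq Φ Φ' fun x => ?_
  by_cases hx : x = 0
  · subst hx
    obtain ⟨θ, hθ⟩ := hΦ
    obtain ⟨θ', hθ'⟩ := hΦ'
    rw [detChar, detChar, Finset.prod_eq_zero hθ (by simp), Finset.prod_eq_zero hθ' (by simp)]
  · exact h x hx

end Summit.Ventures.HodgeRepro2
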